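import Summits.AtomisticToContinuum.Crystallization.Theorems.FrustratedLawDichotomyStrainedPatchTaylorCharge

/-!
# Strained patch — THE HOST READING: the priced descent steps as FINITE-DIMENSIONAL statements per host (the census certificate format)
# (decomp-a2c lens-5 «finite/base range + asymptotic regime + bridge», generation 73 part 2; crux `AperiodicFrustratedLawGap`, stmt-AtomisticToContinuum-27623)

Critic row 1198 (ii): «TYPE the certificate format the census will emit for the descent steps, with its soundness lemma, so census output is consumable by
`tubeFloor_of_quadPrice_descent` without re-typing».  The steps `PriceTop 𝓘 τ (quadPrice B T r) ρ` / `PriceStep 𝓘 τ σ (quadPrice B T r) H F X κ ρ` quantify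
over ALL admissible charted clusters `(M, z, c, e)`; but the price and the polytope rows read the cluster only through the chart's HOST READING — the
occupancy `O = e(ball) ⊆ Fin M₀` and the displacement field `D = dev ∘ e⁻¹` on it.  This module proves the reduction: a statement over the finitely many
occupancies sandwiched between the host balls of radii `63/10 ∓ τ` and over displacement fields `‖D‖ ≤ τ` on them (`HostTop`, `HostStep`: semialgebraic,
finite-dimensional, ONE sup per host cell — exactly what interval branch-and-bound / Shor-SDP certify) IMPLIES the cluster-quantified step.  Reach rows are
read with the `τ`-slop both ways: constraints are USED only at host rows that are reach rows for sure (`HostSureReach`, radii `9/5 − τ`, `9/2 − 2τ`), the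
bound is PROVED at every row that may be a reach row (`HostMaybeReach`, radii `9/5 + τ`, `9/2 + 2τ`).

No `sorry`, no new axioms, zero edits to landed declarations.
-/

namespace Summit.AtomisticToContinuum.Crystallization.Theorems.FrustratedLawDichotomyStrainedPatchHostStep

open scoped BigOperators Classical RealInnerProductSpace
open Summit.AtomisticToContinuum.Crystallization.Theorems.FrustratedLawDichotomyMotifLemmas
open Summit.AtomisticToContinuum.Crystallization.Theorems.FrustratedLawDichotomyAveragingCut
open Summit.AtomisticToContinuum.Crystallization.Theorems.FrustratedLawDichotomyStrainedPatchHomSplit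
open Summit.AtomisticToContinuum.Crystallization.Theorems.FrustratedLawDichotomyStrainedPatchCleanCollar
open Summit.AtomisticToContinuum.Crystallization.Theorems.FrustratedLawDichotomyStrainedPatchPhaseCut
open Summit.AtomisticToContinuum.Crystallization.Theorems.FrustratedLawDichotomyStrainedPatchCoreTube
open Summit.AtomisticToContinuum.Crystallization.Theorems.FrustratedLawDichotomyStrainedPatchStrainBands
open Summit.AtomisticToContinuum.Crystallization.Theorems.FrustratedLawDichotomyStrainedPatchHomIsometry
open Summit.AtomisticToContinuum.Crystallization.Theorems.FrustratedLawDichotomyStrainedPatchHomTubeIso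
open Summit.AtomisticToContinuum.Crystallization.Theorems.FrustratedLawDichotomyStrainedPatchEnvelopeLaw
open Summit.AtomisticToContinuum.Crystallization.Theorems.FrustratedLawDichotomyStrainedPatchEnvelopeTaylor
open Summit.AtomisticToContinuum.Crystallization.Theorems.FrustratedLawDichotomyStrainedPatchChartFamilies
open Summit.AtomisticToContinuum.Crystallization.Theorems.FrustratedLawDichotomyStrainedPatchChartFamiliesPinned
open Summit.AtomisticToContinuum.Crystallization.Theorems.FrustratedLawDichotomyStrainedPatchQuantSlaving
open Summit.AtomisticToContinuum.Crystallization.Theorems.FrustratedLawDichotomyStrainedPatchHostCells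
open Summit.AtomisticToContinuum.Crystallization.Theorems.FrustratedLawDichotomyStrainedPatchForceCap
open Summit.AtomisticToContinuum.Crystallization.Theorems.FrustratedLawDichotomyStrainedPatchTextureFloor
open Summit.AtomisticToContinuum.Crystallization.Theorems.FrustratedLawDichotomyStrainedPatchSVCharge
open Summit.AtomisticToContinuum.Crystallization.Theorems.FrustratedLawDichotomyStrainedPatchChargePrice
open Summit.AtomisticToContinuum.Crystallization.Theorems.FrustratedLawDichotomyStrainedPatchTaylorTop
open Summit.AtomisticToContinuum.Crystallization.Theorems.FrustratedLawDichotomyStrainedPatchTaylorCharge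

/-! ## §1. Host-side objects: occupancy, displacement field, linear rows, the quadratic price, reach predicates, the two step formats -/

/-- The host LINEAR ROW through tables `(H, F)` at occupancy `O`, displacement field `D`, row `h`: `F(z₀)(h) + Σ_{h' ∈ O} H(z₀)(h, h') (D h')`. -/
noncomputable def hostLin (H : HessTab) (F : ForceTab) {M₀ : ℕ} (z₀ : Fin M₀ → E3) (c₀ : Fin M₀) (O : Finset (Fin M₀)) (D : Fin M₀ → E3) (h : Fin M₀) : E3 :=
  F M₀ z₀ c₀ h + ∑ h' ∈ O, H M₀ z₀ c₀ h h' (D h')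

/-- The host NEAR SET of row `h`: occupied sites `h' ≠ h` within `r` of `h`. -/
noncomputable def hostNear (r : ℝ) {M₀ : ℕ} (z₀ : Fin M₀ → E3) (O : Finset (Fin M₀)) (h : Fin M₀) : Finset (Fin M₀) :=
  O.filter (fun h' => h' ≠ h ∧ dist (z₀ h') (z₀ h) < r)

/-- The host QUADRATIC PRICE of row `h` (`quadPrice` read on the host). -/
noncomputable def hostQuad (B : E3 → E3 →L[ℝ] E3 →L[ℝ] E3) (T : ℝ → ℝ → ℝ) (r : ℝ) {M₀ : ℕ} (z₀ : Fin M₀ → E3) (O : Finset (Fin M₀)) (D : Fin M₀ → E3)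
    (h : Fin M₀) : ℝ :=
  ‖(1 / 2 : ℝ) • ∑ h' ∈ hostNear r z₀ O h, B (z₀ h' - z₀ h) (D h' - D h) (D h' - D h)‖ + ∑ h' ∈ hostNear r z₀ O h, T ‖z₀ h' - z₀ h‖ ‖D h' - D h‖

/-- Row `h` is a reach row FOR SURE (whatever the `τ`-chart): an occupied site within `9/5 − τ` of the centre lies within `9/2 − 2τ` of `h`. -/
def HostSureReach (τ : ℝ) {M₀ : ℕ} (z₀ : Fin M₀ → E3) (c₀ : Fin M₀) (O : Finset (Fin M₀)) (h : Fin M₀) : Prop :=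
  ∃ j₀ ∈ O, dist (z₀ j₀) (z₀ c₀) ≤ 9 / 5 - τ ∧ dist (z₀ h) (z₀ j₀) ≤ 9 / 2 - 2 * τ

/-- Row `h` MAY BE a reach row of some `τ`-chart: an occupied site within `9/5 + τ` of the centre lies within `9/2 + 2τ` of `h`. -/
def HostMaybeReach (τ : ℝ) {M₀ : ℕ} (z₀ : Fin M₀ → E3) (c₀ : Fin M₀) (O : Finset (Fin M₀)) (h : Fin M₀) : Prop :=
  ∃ j₀ ∈ O, dist (z₀ j₀) (z₀ c₀) ≤ 9 / 5 + τ ∧ dist (z₀ h) (z₀ j₀) ≤ 9 / 2 + 2 * τ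

/-- An ADMISSIBLE HOST READING `(O, D)`: the occupancy contains the centre and every host site within `63/10 − τ` of it, lies within `63/10 + τ`, and the
displacement field is `≤ τ` on it and vanishes at the centre. -/
def HostReading (τ : ℝ) {M₀ : ℕ} (z₀ : Fin M₀ → E3) (c₀ : Fin M₀) (O : Finset (Fin M₀)) (D : Fin M₀ → E3) : Prop :=
  c₀ ∈ O ∧ (∀ h, dist (z₀ h) (z₀ c₀) ≤ 63 / 10 - τ → h ∈ O) ∧ (∀ h ∈ O, dist (z₀ h) (z₀ c₀) ≤ 63 / 10 + τ) ∧ (∀ h ∈ O, ‖D h‖ ≤ τ) ∧ D c₀ = 0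

/-- ★ **(HTOP) `HostTop 𝓘 τ B T r ρ`** [INSTRUMENTABLE · finite-dimensional per host — the census's box top `k 0 · σ₁`]: on every instance of the family, every
admissible host reading and every maybe-reach row, the host quadratic price is `≤ ρ`. -/
def HostTop (𝓘 : ChartFam) (τ : ℝ) (B : E3 → E3 →L[ℝ] E3 →L[ℝ] E3) (T : ℝ → ℝ → ℝ) (r ρ : ℝ) : Prop :=
  ∀ (M₀ : ℕ) (z₀ : Fin M₀ → E3) (c₀ : Fin M₀), 𝓘 M₀ z₀ c₀ → ∀ (O : Finset (Fin M₀)) (D : Fin M₀ → E3), HostReading τ z₀ c₀ O D →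
    ∀ h ∈ O, HostMaybeReach τ z₀ c₀ O h → hostQuad B T r z₀ O D h ≤ ρ

/-- ★ **(HSTEP) `HostStep 𝓘 τ σ B T r H F X κ ρ`** [INSTRUMENTABLE · finite-dimensional per host — the census's descent step `k ↦ U(k)`: ONE constrained sup per host
cell and occupancy] — on every instance, every admissible host reading whose linear rows at the SURE-reach rows are in the `κ`-inflated polytope, the host
quadratic price of every MAYBE-reach row is `≤ ρ`. -/
def HostStep (𝓘 : ChartFam) (τ σ : ℝ) (B : E3 → E3 →L[ℝ] E3 →L[ℝ] E3) (T : ℝ → ℝ → ℝ) (r : ℝ) (H : HessTab) (F : ForceTab) (X : SlackTab) (κ ρ : ℝ) : Prop :=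
  ∀ (M₀ : ℕ) (z₀ : Fin M₀ → E3) (c₀ : Fin M₀), 𝓘 M₀ z₀ c₀ → ∀ (O : Finset (Fin M₀)) (D : Fin M₀ → E3), HostReading τ z₀ c₀ O D →
    (∀ h ∈ O, HostSureReach τ z₀ c₀ O h → ‖hostLin H F z₀ c₀ O D h‖ ≤ (1 + κ) * σ + X M₀ z₀ c₀ h) →
      ∀ h ∈ O, HostMaybeReach τ z₀ c₀ O h → hostQuad B T r z₀ O D h ≤ ρ

/-- A step is a top with a hypothesis: (HTOP ρ) ⟹ (HSTEP κ ρ) for every `κ`. [formal bookkeeping] -/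
theorem hostStep_of_hostTop {𝓘 : ChartFam} {τ : ℝ} {B : E3 → E3 →L[ℝ] E3 →L[ℝ] E3} {T : ℝ → ℝ → ℝ} {r ρ : ℝ} (h : HostTop 𝓘 τ B T r ρ) (σ : ℝ)
    (H : HessTab) (F : ForceTab) (X : SlackTab) (κ : ℝ) : HostStep 𝓘 τ σ B T r H F X κ ρ :=
  fun M₀ z₀ c₀ hI O D hR _ => h M₀ z₀ c₀ hI O D hR

/-! ## §2. The host reading of a chart -/

section Reading

variable {M : ℕ} (z : Fin M → E3) (c : Fin M) {M₀ : ℕ} (z₀ : Fin M₀ → E3) (c₀ : Fin M₀) (e : Fin M → Fin M₀)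

/-- The chart's OCCUPANCY: the host images of the charted ball. -/
noncomputable def occ : Finset (Fin M₀) := (ball (63 / 10) z c).image e

/-- The chart's DISPLACEMENT FIELD on the host: `dev` pulled back along `e` (zero off the occupancy). -/
noncomputable def disp : Fin M₀ → E3 := fun h =>
  if hh : ∃ a ∈ ball (63 / 10) z c, e a = h then dev z c z₀ c₀ e (Classical.choose hh) else 0

variable {z c z₀ c₀ e}

/-- On the ball, `disp (e a) = dev a` (injectivity of the chart). [formal bookkeeping] -/
theorem disp_apply (hinj : ∀ b b', b ∈ ball (63 / 10) z c → b' ∈ ball (63 / 10) z c → e b = e b' → b = b') {a : Fin M} (ha : a ∈ ball (63 / 10) z c) :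
    disp z c z₀ c₀ e (e a) = dev z c z₀ c₀ e a := by
  have hex : ∃ a' ∈ ball (63 / 10) z c, e a' = e a := ⟨a, ha, rfl⟩
  rw [disp, dif_pos hex]
  obtain ⟨ha', he'⟩ := Classical.choose_spec hex
  rw [hinj _ _ ha' ha he']

/-- Membership in the occupancy. [formal bookkeeping] -/
theorem mem_occ {h : Fin M₀} : h ∈ occ z c e ↔ ∃ a ∈ ball (63 / 10) z c, e a = h := Finset.mem_image

/-- `mem_occ_of_mem` (docstring added by the landing lane; see the module docstring). [formal bookkeeping] -/
theorem mem_occ_of_mem {a : Fin M} (ha : a ∈ ball (63 / 10) z c) : e a ∈ occ z c e := mem_occ.2 ⟨a, ha, rfl⟩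

/-- The centre is in its own ball. [formal bookkeeping] -/
theorem centre_mem_ball : c ∈ ball (63 / 10) z c := mem_ball.2 (by rw [dist_self]; norm_num)

/-- Host offsets from chart data: `z₀ (e a) − z₀ c₀ = (z a − z c) − dev a`. [formal bookkeeping] -/
theorem host_offset_eq (a : Fin M) : z₀ (e a) - z₀ c₀ = (z a - z c) - dev z c z₀ c₀ e a := by simp only [dev]; abel

/-- Host bonds from chart data: `z₀ (e a) − z₀ (e b) = (z a − z b) − (dev a − dev b)`. [formal bookkeeping] -/
theorem host_bond_eq (a b : Fin M) : z₀ (e a) - z₀ (e b) = (z a - z b) - (dev z c z₀ c₀ e a - dev z c z₀ c₀ e b) := by simp only [dev]; abel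

/-- ★ **A `τ`-CHART READS AS AN ADMISSIBLE HOST READING.** [formal bookkeeping over ChartBy's clauses + FineChart] -/
theorem hostReading_of_chart {𝓘 : ChartFam} {τ t : ℝ} (hch : ChartBy 𝓘 τ t z c z₀ c₀ e) (hf : FineChart τ z c z₀ c₀ e) :
    HostReading τ z₀ c₀ (occ z c e) (disp z c z₀ c₀ e) := by
  have hinj : ∀ b b', b ∈ ball (63 / 10) z c → b' ∈ ball (63 / 10) z c → e b = e b' → b = b' := fun b b' hb hb' hE =>
    hch.2.2.2.2.1 b b' (mem_ball.1 hb) (mem_ball.1 hb') hE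
  refine ⟨?_, fun h hh => ?_, fun h hh => ?_, fun h hh => ?_, ?_⟩
  · exact mem_occ.2 ⟨c, centre_mem_ball, hch.2.1⟩
  · obtain ⟨a, ha, hE⟩ := hch.2.2.2.2.2 h hh
    exact mem_occ.2 ⟨a, mem_ball.2 ha, hE⟩
  · obtain ⟨a, ha, rfl⟩ := mem_occ.1 hh
    rw [dist_eq_norm, host_offset_eq]
    calc ‖z a - z c - dev z c z₀ c₀ e a‖ ≤ ‖z a - z c‖ + ‖dev z c z₀ c₀ e a‖ := norm_sub_le _ _
      _ ≤ 63 / 10 + τ := add_le_add (by rw [← dist_eq_norm]; exact mem_ball.1 ha) (hf a (mem_ball.1 ha))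
  · obtain ⟨a, ha, rfl⟩ := mem_occ.1 hh
    rw [disp_apply hinj ha]
    exact hf a (mem_ball.1 ha)
  · rw [← hch.2.1, disp_apply hinj centre_mem_ball]
    simp [dev, hch.2.1]

/-- ★ The LINEAR ROW reads on the host: `linForce H F … a = hostLin H F z₀ c₀ O D (e a)`. [formal bookkeeping] -/
theorem linForce_eq_hostLin (H : HessTab) (F : ForceTab)
    (hinj : ∀ b b', b ∈ ball (63 / 10) z c → b' ∈ ball (63 / 10) z c → e b = e b' → b = b') (a : Fin M) :
    linForce H F z c z₀ c₀ e a = hostLin H F z₀ c₀ (occ z c e) (disp z c z₀ c₀ e) (e a) := by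
  have hinjS : Set.InjOn e ↑(ball (63 / 10) z c) := fun b hb b' hb' hE => hinj b b' (Finset.mem_coe.1 hb) (Finset.mem_coe.1 hb') hE
  rw [linForce, hostLin, occ, Finset.sum_image hinjS]
  congr 1
  exact Finset.sum_congr rfl fun a' ha' => by rw [disp_apply hinj ha']

/-- The host image of the near set is the host near set. [formal bookkeeping] -/
theorem image_nearSet_eq (r : ℝ) (hinj : ∀ b b', b ∈ ball (63 / 10) z c → b' ∈ ball (63 / 10) z c → e b = e b' → b = b') {a : Fin M}
    (ha : a ∈ ball (63 / 10) z c) : (nearSet r z c z₀ e a).image e = hostNear r z₀ (occ z c e) (e a) := by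
  ext h'
  simp only [Finset.mem_image, mem_nearSet, hostNear, Finset.mem_filter, mem_occ]
  constructor
  · rintro ⟨b, ⟨hb, hba, hd⟩, rfl⟩
    exact ⟨⟨b, hb, rfl⟩, fun hE => hba (hinj b a hb ha hE), hd⟩
  · rintro ⟨⟨b, hb, rfl⟩, hne, hd⟩
    exact ⟨b, ⟨hb, fun hba => hne (by rw [hba]), hd⟩, rfl⟩

/-- ★ The QUADRATIC PRICE reads on the host: `quadPrice B T r … a = hostQuad B T r z₀ O D (e a)`. [formal bookkeeping] -/
theorem quadPrice_eq_hostQuad (B : E3 → E3 →L[ℝ] E3 →L[ℝ] E3) (T : ℝ → ℝ → ℝ) (r : ℝ)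
    (hinj : ∀ b b', b ∈ ball (63 / 10) z c → b' ∈ ball (63 / 10) z c → e b = e b' → b = b') {a : Fin M} (ha : a ∈ ball (63 / 10) z c) :
    quadPrice B T r M z c M₀ z₀ c₀ e a = hostQuad B T r z₀ (occ z c e) (disp z c z₀ c₀ e) (e a) := by
  have hinjS : Set.InjOn e ↑(nearSet r z c z₀ e a) := fun b hb b' hb' hE =>
    hinj b b' (mem_nearSet.1 (Finset.mem_coe.1 hb)).1 (mem_nearSet.1 (Finset.mem_coe.1 hb')).1 hE
  have hD : ∀ b ∈ nearSet r z c z₀ e a, disp z c z₀ c₀ e (e b) - disp z c z₀ c₀ e (e a) = dev z c z₀ c₀ e b - dev z c z₀ c₀ e a := fun b hb => by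
    rw [disp_apply hinj (mem_nearSet.1 hb).1, disp_apply hinj ha]
  rw [hostQuad, ← image_nearSet_eq r hinj ha, Finset.sum_image hinjS, Finset.sum_image hinjS,
    Finset.sum_congr rfl fun b hb => by rw [hD b hb], Finset.sum_congr rfl fun b hb => show T ‖z₀ (e b) - z₀ (e a)‖ ‖disp z c z₀ c₀ e (e b) - disp z c z₀ c₀ e (e a)‖ =
      T ‖z₀ (e b) - z₀ (e a)‖ ‖dev z c z₀ c₀ e b - dev z c z₀ c₀ e a‖ by rw [hD b hb]]
  rfl

/-- ★ A cluster reach row reads as a MAYBE-reach host row. [formal bookkeeping] -/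
theorem hostMaybeReach_of_isReach {τ : ℝ} (hf : FineChart τ z c z₀ c₀ e) {a : Fin M} (ha : a ∈ ball (63 / 10) z c) (hr : IsReach z c a) :
    HostMaybeReach τ z₀ c₀ (occ z c e) (e a) := by
  obtain ⟨j, hj, hd⟩ := hr
  have hjB : j ∈ ball (63 / 10) z c := mem_ball.2 ((mem_ball.1 hj).trans (by norm_num))
  refine ⟨e j, mem_occ_of_mem hjB, ?_, ?_⟩
  · rw [dist_eq_norm, host_offset_eq]
    calc ‖z j - z c - dev z c z₀ c₀ e j‖ ≤ ‖z j - z c‖ + ‖dev z c z₀ c₀ e j‖ := norm_sub_le _ _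
      _ ≤ 9 / 5 + τ := add_le_add (by rw [← dist_eq_norm]; exact mem_ball.1 hj) (hf j (mem_ball.1 hjB))
  · rw [dist_eq_norm, host_bond_eq]
    calc ‖z a - z j - (dev z c z₀ c₀ e a - dev z c z₀ c₀ e j)‖ ≤ ‖z a - z j‖ + (‖dev z c z₀ c₀ e a‖ + ‖dev z c z₀ c₀ e j‖) :=
          (norm_sub_le _ _).trans (by gcongr; exact norm_sub_le _ _)
      _ ≤ 9 / 2 + (τ + τ) := add_le_add (by rw [← dist_eq_norm]; exact hd) (add_le_add (hf a (mem_ball.1 ha)) (hf j (mem_ball.1 hjB)))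
      _ = 9 / 2 + 2 * τ := by ring

/-- ★ A SURE-reach host row is the image of a cluster reach row. [formal bookkeeping] -/
theorem isReach_of_hostSureReach {τ : ℝ} (hf : FineChart τ z c z₀ c₀ e) {h : Fin M₀} (hh : h ∈ occ z c e)
    (hs : HostSureReach τ z₀ c₀ (occ z c e) h) : ∃ a ∈ ball (63 / 10) z c, e a = h ∧ IsReach z c a := by
  obtain ⟨a, ha, rfl⟩ := mem_occ.1 hh
  obtain ⟨j₀, hj₀, hd1, hd2⟩ := hs
  obtain ⟨j, hj, rfl⟩ := mem_occ.1 hj₀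
  refine ⟨a, ha, rfl, j, mem_ball.2 ?_, ?_⟩
  · rw [dist_eq_norm, show z j - z c = (z₀ (e j) - z₀ c₀) + dev z c z₀ c₀ e j by simp only [dev]; abel]
    calc ‖z₀ (e j) - z₀ c₀ + dev z c z₀ c₀ e j‖ ≤ ‖z₀ (e j) - z₀ c₀‖ + ‖dev z c z₀ c₀ e j‖ := norm_add_le _ _
      _ ≤ (9 / 5 - τ) + τ := add_le_add (by rw [← dist_eq_norm]; exact hd1) (hf j (mem_ball.1 hj))
      _ = 9 / 5 := by ring
  · rw [dist_eq_norm, sub_eq_hostBond_add_devDiff z c z₀ c₀ e j a]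
    calc ‖z₀ (e a) - z₀ (e j) + (dev z c z₀ c₀ e a - dev z c z₀ c₀ e j)‖ ≤ ‖z₀ (e a) - z₀ (e j)‖ + (‖dev z c z₀ c₀ e a‖ + ‖dev z c z₀ c₀ e j‖) :=
          (norm_add_le _ _).trans (by gcongr; exact norm_sub_le _ _)
      _ ≤ (9 / 2 - 2 * τ) + (τ + τ) := add_le_add (by rw [← dist_eq_norm]; exact hd2) (add_le_add (hf a (mem_ball.1 ha)) (hf j (mem_ball.1 hj)))
      _ = 9 / 2 := by ring

end Reading

/-! ## §3. SOUNDNESS: the host formats imply the cluster-quantified steps; the record with host tables -/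

/-- ★★ **`priceTop_of_hostTop`** — (HTOP ρ) ⟹ `PriceTop 𝓘 τ (quadPrice B T r) ρ`. [formal bookkeeping over §2] -/
theorem priceTop_of_hostTop {𝓘 : ChartFam} {τ : ℝ} {B : E3 → E3 →L[ℝ] E3 →L[ℝ] E3} {T : ℝ → ℝ → ℝ} {r ρ : ℝ} (hH : HostTop 𝓘 τ B T r ρ) :
    PriceTop 𝓘 τ (quadPrice B T r) ρ := by
  intro M z c M₀ z₀ c₀ e t hz hcl hm ht htT hch hf a ha hr
  have hinj : ∀ b b', b ∈ ball (63 / 10) z c → b' ∈ ball (63 / 10) z c → e b = e b' → b = b' := fun b b' hb hb' hE =>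
    hch.2.2.2.2.1 b b' (mem_ball.1 hb) (mem_ball.1 hb') hE
  rw [quadPrice_eq_hostQuad B T r hinj ha]
  exact hH M₀ z₀ c₀ hch.1 _ _ (hostReading_of_chart hch hf) (e a) (mem_occ_of_mem ha) (hostMaybeReach_of_isReach hf ha hr)

/-- ★★★ **`priceStep_of_hostStep`** (the critic's `priceStep_of_cert`) — (HSTEP κ ρ) ⟹ `PriceStep 𝓘 τ σ (quadPrice B T r) H F X κ ρ`: the polytope rows of the
chart transfer to the SURE-reach host rows, the conclusion transfers back from the MAYBE-reach host rows. [formal bookkeeping over §2] -/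
theorem priceStep_of_hostStep {𝓘 : ChartFam} {τ σ : ℝ} {B : E3 → E3 →L[ℝ] E3 →L[ℝ] E3} {T : ℝ → ℝ → ℝ} {r : ℝ} {H : HessTab} {F : ForceTab} {X : SlackTab}
    {κ ρ : ℝ} (hH : HostStep 𝓘 τ σ B T r H F X κ ρ) : PriceStep 𝓘 τ σ (quadPrice B T r) H F X κ ρ := by
  intro M z c M₀ z₀ c₀ e t hz hcl hm ht htT hch hf hP a ha hr
  have hinj : ∀ b b', b ∈ ball (63 / 10) z c → b' ∈ ball (63 / 10) z c → e b = e b' → b = b' := fun b b' hb hb' hE =>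
    hch.2.2.2.2.1 b b' (mem_ball.1 hb) (mem_ball.1 hb') hE
  rw [quadPrice_eq_hostQuad B T r hinj ha]
  refine hH M₀ z₀ c₀ hch.1 _ _ (hostReading_of_chart hch hf) (fun h hh hs => ?_) (e a) (mem_occ_of_mem ha) (hostMaybeReach_of_isReach hf ha hr)
  obtain ⟨a', ha', rfl, hr'⟩ := isReach_of_hostSureReach hf hh hs
  rw [← linForce_eq_hostLin H F hinj a']
  exact hP a' ha' hr'

/-- ★★★ **THE T-LEAF RECORD WITH HOST TABLES** — `[CORE-FAR]` from: the cover, the per-bond second-derivative data (C2L) at `m = 2τ`, host separation, the far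
column, a HOST top `k 0 · σ₁`, a finite table of HOST steps `k i ↦ k (i+1) · σ₁`, and the first-order certificate at `k n`.  Every analytic binder is now either
per-bond calculus (C2L) or a finite-dimensional statement per host cell. [formal bookkeeping: g73 part 1 + the two soundness lemmas + g72's descent] -/
theorem coreOff_of_hostTables {𝓘 : ChartFam} {τ s₀ r : ℝ} {B : E3 → E3 →L[ℝ] E3 →L[ℝ] E3} {L : ℝ → ℝ} {X : SlackTab} (k : ℕ → ℝ) (n : ℕ) (hτ : 0 ≤ τ)
    (hcov : FamilyCover 𝓘 (24 / 5) (1 / 100) (1 / 8) τ) (hC : BondHessLip B L s₀ r (2 * τ)) (hsep : HostSep 𝓘 s₀) (hX : FarColumn 𝓘 τ r X)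
    (h0 : HostTop 𝓘 τ B (cubicTail L) r (k 0 * sigmaOne))
    (hs : ∀ i : ℕ, i < n → HostStep 𝓘 τ sigmaOne B (cubicTail L) r hessBlk0 force0 X (k i) (k (i + 1) * sigmaOne))
    (hcert : SlackCert 𝓘 τ (k n) sigmaOne hessBlk0 force0 X) : CoreOffTubeFloor (63 / 10) (63 / 10) (24 / 5) (1 / 100) 0 :=
  coreOff_of_bondHessLip_descent k n hτ hcov hC hsep hX (priceTop_of_hostTop h0) (fun i hi => priceStep_of_hostStep (hs i hi)) hcert

end Summit.AtomisticToContinuum.Crystallization.Theorems.FrustratedLawDichotomyStrainedPatchHostStep
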